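import Literature.NumberTheory.DiophantineGeometry.FunctionFieldHilbertRamification
import HarnessLib

/-!
# Places above a place in a constant field extension are rational when the degrees allow
(Stichtenoth Lemma 5.1.9 (a),(d) / Thm. 3.6.3 (g))

Sibling **proof file** (theorems only; no named facts) in the chain discharging the named fact
`hasseWeil` of `FunctionFieldZeta` (**Stichtenoth Thm. 5.2.1**, Bombieri's proof). It supplies, for the
constant field extension model `F' = F[X]/(φ)`, `K' = 𝔽_q[X]/(φ)` of `FunctionFieldConstantExtension`
(`φ ∈ 𝔽_q[X]` irreducible of degree `t`, `𝔽_q` the full constant field of `F`), the hypothesis `hsplit`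
of the double count `PlaceOver.mul_sum_natCard_fixed_eq_card_mul_pointCount`
(`FunctionFieldHilbertRamification`):

* `isGalois_adjoinRoot_map`: `F'/F` is Galois (the splitting field of `φ`: the conjugates `α^{q^i}`,
  `i < t`, are distinct roots; **Lemma 5.1.9 (a)**, `Gal(F'/F) = ⟨σ⟩`, `σ(α) = α^q`);
* `frob_pow_algebraMap`: `σ^i(c) = c^{q^i}` for the constants `c ∈ K'`;
* `degree_dvd_of_comapRingEquiv_frob_pow_eq` (**key lemma**): if `deg P = s` divides `t` and
  `σ^i(Q) = Q` for a place `Q` of `F'` above `P`, then `s ∣ i` (the induced `F_P`-automorphism of the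
  finite field `F'_Q` is `x ↦ x^{q^{sm}}` and acts on `K'` as `c ↦ c^{q^i}`, so `i ≡ sm (mod t)`);
* `degree_le_natCard_restrict_eq`: hence at least `s` places of `F'` lie above `P`;
* **`isRational_of_restrict_eq`** (**Lemma 5.1.9 (d)** / Thm. 3.6.3 (g), the case `deg P ∣ t`): every
  place of `F'` above a place `P` of `F` with `deg P ∣ t` is `K'`-rational. Proof: for the primes `𝔔`
  of the integral closure `B` of `𝒪_P` in `F'`, `B/𝔔 ⊇ K'` gives `s · f(𝔔|P) ≥ t`, Hilbert theory
  (Mathlib `Ideal.ncard_primesOver_mul_card_inertia_mul_finrank`) gives `#{𝔔} · e · f = t` with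
  `#{𝔔} ≥ s`; so `s f = t`, `#F'_Q = #(B/𝔔) = #K'`.
* `PlaceOver.quotientToResidueField_surjective`: `B/𝔔 ≅ 𝒪_Q/Q` (complement to the bridge file).

## References

* H. Stichtenoth, *Algebraic Function Fields and Codes*, 2nd ed., GTM 254, Springer 2009,
  Lemma 5.1.9, Thm. 3.6.3, Thm. 3.3.7, Thm. 3.8.2. [Stichtenoth2009]
* E. Bombieri, *Counting points on curves over finite fields (d'après S. A. Stepanov)*,
  Sém. Bourbaki 430 (1973).
-/

noncomputable section

open scoped Classical Polynomial

namespace Literature.NumberTheory.DiophantineGeometry.AlgFunctionField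

open Polynomial

universe u v

/-! ### A. The constant field extension `F' = F[X]/(φ)` is Galois over `F` -/

section Model

variable {K : Type u} {F : Type v} [Field K] [Fintype K] [Field F] [Algebra K F]
  [IsIntegrallyClosedIn K F]
variable (φ : K[X]) [hirr : Fact (Irreducible φ)]

/-- **`σ^i` acts on the constants `K' = 𝔽_q(α)` as the `q^i`-Frobenius**: `σ^i(c) = c^{q^i}` for
`c ∈ K'` (both sides are `K`-algebra maps `K' → F'` agreeing on `α`). [cite: Stichtenoth2009, Lemma 5.1.9(a)] -/
theorem frob_pow_algebraMap (i : ℕ) (c : AdjoinRoot φ) :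
    (frob φ ^ i) (algebraMap (AdjoinRoot φ) (AdjoinRoot (φ.map (algebraMap K F))) c) =
      algebraMap (AdjoinRoot φ) (AdjoinRoot (φ.map (algebraMap K F))) (c ^ (Fintype.card K ^ i)) := by
  obtain ⟨p, rfl⟩ := AdjoinRoot.mk_surjective c
  have e1 : (AdjoinRoot.mk φ p) ^ (Fintype.card K ^ i) =
      aeval (AdjoinRoot.root φ ^ (Fintype.card K ^ i)) p := by
    rw [← AdjoinRoot.aeval_eq]
    have h := Polynomial.aeval_algHom_apply (FiniteField.frobeniusAlgHom K (AdjoinRoot φ) ^ i)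
      (AdjoinRoot.root φ) p
    simp only [AlgHom.coe_pow, FiniteField.coe_frobeniusAlgHom, pow_iterate] at h
    exact h.symm
  rw [e1, ← AdjoinRoot.aeval_eq, ← Polynomial.aeval_algebraMap_apply, ← Polynomial.aeval_algebraMap_apply,
    map_pow, algebraMap_root, ← frob_pow_root φ i]
  exact (Polynomial.aeval_algHom_apply ((frob φ ^ i).restrictScalars K) _ p).symm

/-- The powers `α^{q^i}`, `i < deg φ`, of the root are pairwise distinct. [folklore] -/
theorem root_map_pow_injective :
    Function.Injective fun i : Fin φ.natDegree =>
      AdjoinRoot.root (φ.map (algebraMap K F)) ^ (Fintype.card K ^ (i : ℕ)) := by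
  intro i j hij
  simp only at hij
  by_contra hne
  wlog hlt : (i : ℕ) < j generalizing i j
  · exact this hij.symm (Ne.symm hne) (lt_of_le_of_ne (not_lt.1 hlt) (fun h => hne (Fin.ext h).symm))
  have h1 : (frob φ ^ (i : ℕ)) (AdjoinRoot.root (φ.map (algebraMap K F))) =
      (frob φ ^ (i : ℕ)) (AdjoinRoot.root (φ.map (algebraMap K F)) ^ (Fintype.card K ^ ((j : ℕ) - i))) := by
    rw [map_pow, frob_pow_root, ← pow_mul, ← pow_add, Nat.add_sub_cancel' hlt.le]
    exact hij
  have h2 := (frob φ ^ (i : ℕ)).injective h1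
  exact root_map_pow_ne φ (Nat.sub_pos_of_lt hlt) (lt_of_le_of_lt (Nat.sub_le _ _) j.2) h2.symm

omit [IsIntegrallyClosedIn K F] in
/-- `φ` is separable (irreducible over the perfect field `𝔽_q`). [folklore] -/
theorem separable_map : (φ.map (algebraMap K F)).Separable :=
  (PerfectField.separable_of_irreducible hirr.out).map

/-- **`F' = F(α)` is the splitting field of `φ` over `F`**: the `deg φ` distinct conjugates
`α^{q^i}` are roots (Stichtenoth Lemma 5.1.9 (a): `F'/F` is cyclic, generated by the Frobenius).
[cite: Stichtenoth2009, Lemma 5.1.9(a)] -/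
theorem isSplittingField_adjoinRoot_map :
    IsSplittingField F (AdjoinRoot (φ.map (algebraMap K F))) (φ.map (algebraMap K F)) := by
  set α := AdjoinRoot.root (φ.map (algebraMap K F)) with hα
  set p := (φ.map (algebraMap K F)).map (algebraMap F (AdjoinRoot (φ.map (algebraMap K F)))) with hp
  have hp0 : p ≠ 0 := Polynomial.map_ne_zero (fact_irreducible_map φ).out.ne_zero
  have hdeg : p.natDegree = φ.natDegree := by rw [hp, natDegree_map, natDegree_map]
  have hroots : ∀ i : ℕ, α ^ (Fintype.card K ^ i) ∈ p.roots := by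
    intro i
    rw [mem_roots hp0, IsRoot.def, hp, eval_map, ← aeval_def, hα, ← frob_pow_root,
      aeval_algHom_apply, aeval_map_algebraMap, aeval_root_map, map_zero]
  have hsplits : p.Splits := by
    rw [splits_iff_card_roots, hdeg]
    apply le_antisymm (hdeg ▸ card_roots' p)
    set S : Finset (AdjoinRoot (φ.map (algebraMap K F))) :=
      Finset.univ.image fun i : Fin φ.natDegree => α ^ (Fintype.card K ^ (i : ℕ)) with hS
    have hScard : S.card = φ.natDegree := by
      rw [hS, Finset.card_image_of_injective _ (root_map_pow_injective φ), Finset.card_univ,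
        Fintype.card_fin]
    have hSsub : S ⊆ p.roots.toFinset := by
      intro x hx
      rw [hS, Finset.mem_image] at hx
      obtain ⟨i, -, rfl⟩ := hx
      exact Multiset.mem_toFinset.2 (hroots i)
    calc φ.natDegree = S.card := hScard.symm
      _ ≤ p.roots.toFinset.card := Finset.card_le_card hSsub
      _ ≤ p.roots.card := Multiset.toFinset_card_le _
  refine ⟨hsplits, ?_⟩
  apply top_unique
  rw [← AdjoinRoot.adjoinRoot_eq_top]
  refine Algebra.adjoin_mono (Set.singleton_subset_iff.2 ?_)
  rw [mem_rootSet]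
  exact ⟨(fact_irreducible_map φ).out.ne_zero, by rw [aeval_map_algebraMap]; exact aeval_root_map φ⟩

/-- **`F'/F` is Galois** (cyclic of order `deg φ`, Stichtenoth Lemma 5.1.9 (a)). [cite: Stichtenoth2009, Lemma 5.1.9(a)] -/
theorem isGalois_adjoinRoot_map : IsGalois F (AdjoinRoot (φ.map (algebraMap K F))) :=
  haveI := isSplittingField_adjoinRoot_map (F := F) φ
  IsGalois.of_separable_splitting_field (separable_map φ)

/-- `|Gal(F'/F)| = deg φ`. [cite: Stichtenoth2009, Lemma 5.1.9(a)] -/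
theorem natCard_algEquiv_adjoinRoot_map :
    Nat.card (AdjoinRoot (φ.map (algebraMap K F)) ≃ₐ[F] AdjoinRoot (φ.map (algebraMap K F))) =
      φ.natDegree := by
  haveI := isGalois_adjoinRoot_map (F := F) φ
  rw [IsGalois.card_aut_eq_finrank, finrank_adjoinRoot_map]

end Model

/-! ### B. `B/𝔔 → 𝒪_Q/Q` is onto (so `B/𝔔 ≅ 𝒪_Q/Q`) -/

namespace PlaceOver

section Residue

universe w

variable {k : Type u} {L : Type v} [Field k] [Field L] [Algebra k L]
variable {Ω : Type w} [Field Ω] [Algebra L Ω]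
variable {P : PlaceOver k L} [FiniteDimensional L Ω] [Algebra.IsSeparable L Ω]
variable {K' : Type*} [Field K'] [Finite K'] [Algebra K' Ω] [IsAlgFunctionField K' Ω]

/-- **`B/𝔔 → 𝒪_Q/Q` is surjective** (`𝒪_Q = B_𝔔`: an element of `𝒪_Q` is `n/d` with `n, d ∈ B`,
`d ∉ 𝔔`, and `B/𝔔` is a field). Together with `quotientToResidueField_injective`:
`B/𝔔 ≅ 𝒪_Q/Q`. [cite: Stichtenoth2009, Thm. 3.3.7 (proof)] -/
theorem quotientToResidueField_surjective (Q : PlaceOver K' Ω)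
    (hQP : ∀ x : L, algebraMap L Ω x ∈ Q.toValuationSubring ↔ x ∈ P.toValuationSubring) :
    Function.Surjective (quotientToResidueField Q hQP) := by
  letI : Field (integralClosure P.toValuationSubring Ω ⧸ primeBelow Q hQP) := Ideal.Quotient.field _
  intro t
  obtain ⟨x, rfl⟩ := IsLocalRing.residue_surjective t
  -- `x = n / d` with `n, d ∈ B`, `d ∉ 𝔔`
  have hx : ((⟨primeBelow Q hQP, inferInstance, primeBelow_ne_bot Q hQP⟩ :
      IsDedekindDomain.HeightOneSpectrum (integralClosure P.toValuationSubring Ω)).valuation Ω) (x : Ω) ≤ 1 := by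
    have h := ofPrimeIntegralClosure_primeBelow (K' := K') Q hQP
    have hxmem : (x : Ω) ∈ (ofPrimeIntegralClosure (K' := K')
        ⟨primeBelow Q hQP, inferInstance, primeBelow_ne_bot Q hQP⟩).toValuationSubring := by
      rw [h]; exact x.2
    exact hxmem
  obtain ⟨n, d, hnd⟩ := IsDedekindDomain.HeightOneSpectrum.exists_primeCompl_mul_eq_of_integer _ _ hx
  have hd : Q.valuation (d : integralClosure P.toValuationSubring Ω) = 1 :=
    valuation_eq_one_of_not_mem_primeBelow Q hQP d.2
  have hd0 : Ideal.Quotient.mk (primeBelow Q hQP) (d : integralClosure P.toValuationSubring Ω) ≠ 0 := by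
    rw [Ne, Ideal.Quotient.eq_zero_iff_mem]
    exact d.2
  have hd0' : IsLocalRing.residue Q.toValuationSubring (toValuationSubringHom Q hQP d) ≠ 0 := by
    rw [Ne, IsLocalRing.residue_eq_zero_iff]
    exact d.2
  refine ⟨Ideal.Quotient.mk _ (n : integralClosure P.toValuationSubring Ω) *
    (Ideal.Quotient.mk _ (d : integralClosure P.toValuationSubring Ω))⁻¹, ?_⟩
  rw [map_mul, map_inv₀, quotientToResidueField_mk, quotientToResidueField_mk, eq_comm,
    eq_mul_inv_iff_mul_eq₀ hd0', ← map_mul]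
  congr 1
  apply Subtype.ext
  exact hnd

/-- `#(𝒪_Q/Q) = #(B/𝔔)`. [cite: Stichtenoth2009, Thm. 3.3.7 (proof)] -/
theorem natCard_residueField_eq_natCard_quotient (Q : PlaceOver K' Ω)
    (hQP : ∀ x : L, algebraMap L Ω x ∈ Q.toValuationSubring ↔ x ∈ P.toValuationSubring) :
    Nat.card Q.residueField = Nat.card (integralClosure P.toValuationSubring Ω ⧸ primeBelow Q hQP) :=
  (Nat.card_eq_of_bijective _ ⟨quotientToResidueField_injective Q hQP,
    quotientToResidueField_surjective Q hQP⟩).symm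

end Residue

end PlaceOver

/-! ### C. Frobenius-conjugate places above a place of degree dividing `deg φ` are distinct -/

section Conjugates

variable {K : Type u} {F : Type v} [Field K] [Fintype K] [Field F] [Algebra K F]
  [IsIntegrallyClosedIn K F] [IsAlgFunctionField K F]
variable (φ : K[X]) [hirr : Fact (Irreducible φ)]

/-- **Key lemma** (the residue-field computation behind Stichtenoth Thm. 3.6.3 (g) /
Lemma 5.1.9 (d)): let `P` be a place of `F/𝔽_q` whose degree `s` divides `t = deg φ`, `Q` a place of
the constant field extension `F' = F(α)` above `P`, and suppose `σ^i(Q) = Q` for the Frobenius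
`σ` (`σ(α) = α^q`). Then `s ∣ i`. Indeed `σ^i` induces an `F_P`-automorphism of the finite field
`F'_Q ⊇ F_P = 𝔽_{q^s}`, necessarily `x ↦ x^{q^{sm}}`, which on the image of `K' = 𝔽_q(α)` is
`c ↦ c^{q^i}`; comparing on `K'` (where the Frobenius has order `t`) gives `i ≡ sm (mod t)`.
[cite: Stichtenoth2009, Thm. 3.6.3(g) and Lemma 5.1.9(d)] -/
theorem degree_dvd_of_comapRingEquiv_frob_pow_eq (P : PlaceOver K F)
    (Q : PlaceOver (AdjoinRoot φ) (AdjoinRoot (φ.map (algebraMap K F))))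
    (hQP : ∀ x : F, algebraMap F _ x ∈ Q.toValuationSubring ↔ x ∈ P.toValuationSubring)
    (hst : P.degree ∣ φ.natDegree) {i : ℕ}
    (hfix : Q.comapRingEquiv ((frob φ ^ i : _ ≃ₐ[F] _) : _ ≃+* _) = Q) : P.degree ∣ i := by
  set F' := AdjoinRoot (φ.map (algebraMap K F)) with hF'
  set θ : F' ≃ₐ[F] F' := frob φ ^ i with hθ
  -- `θ` restricted to `𝒪_Q`
  have hθmem : ∀ y : F', θ y ∈ Q.toValuationSubring ↔ y ∈ Q.toValuationSubring := fun y => by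
    change (θ : F' ≃+* F') y ∈ Q.toValuationSubring ↔ _
    rw [← PlaceOver.mem_comapRingEquiv_iff (θ : F' ≃+* F') Q y, hfix]
  let θr : Q.toValuationSubring →+* Q.toValuationSubring :=
    { toFun := fun y => ⟨θ (y : F'), (hθmem y).2 y.2⟩
      map_one' := Subtype.ext (map_one θ)
      map_mul' := fun y z => Subtype.ext (map_mul θ (y : F') z)
      map_zero' := Subtype.ext (map_zero θ)
      map_add' := fun y z => Subtype.ext (map_add θ (y : F') z) }
  haveI : IsLocalHom θr := by
    refine ⟨fun y hy => ?_⟩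
    rw [ValuationSubring.valuation_eq_one_iff] at hy ⊢
    change Q.valuation (θ (y : F')) = 1 at hy
    have hy0 : (y : F') ≠ 0 := by
      intro h0; rw [h0, map_zero, Valuation.map_zero] at hy; exact zero_ne_one hy
    have hinv : (θ (y : F'))⁻¹ ∈ Q.toValuationSubring := by
      rw [← Q.toValuationSubring.valuation_le_one_iff, map_inv₀]
      exact le_of_eq (by rw [show Q.toValuationSubring.valuation (θ (y : F')) = 1 from hy, inv_one])
    rw [← map_inv₀, hθmem] at hinv
    have h1 := (Q.toValuationSubring.valuation_le_one_iff _).2 hinv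
    rw [map_inv₀, inv_le_one₀ ((Valuation.pos_iff _).2 hy0)] at h1
    exact le_antisymm ((Q.toValuationSubring.valuation_le_one_iff _).2 y.2) h1
  -- the induced endomorphism of the residue field, over `F_P`
  set θbar := IsLocalRing.ResidueField.map θr with hθbar
  letI : Algebra P.residueField Q.residueField :=
    (IsLocalRing.ResidueField.map (PlaceOver.resHom P Q hQP)).toAlgebra
  haveI := P.finite_residueField
  haveI := Q.finite_residueField
  letI := Fintype.ofFinite P.residueField
  have hcomm : ∀ a : P.residueField, θbar (algebraMap P.residueField Q.residueField a) =
      algebraMap P.residueField Q.residueField a := by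
    intro a
    obtain ⟨a, rfl⟩ := IsLocalRing.residue_surjective a
    change θbar (IsLocalRing.ResidueField.map (PlaceOver.resHom P Q hQP) (IsLocalRing.residue _ a)) =
      IsLocalRing.ResidueField.map (PlaceOver.resHom P Q hQP) (IsLocalRing.residue _ a)
    rw [IsLocalRing.ResidueField.map_residue, hθbar, IsLocalRing.ResidueField.map_residue]
    change IsLocalRing.residue _ (θr (PlaceOver.resHom P Q hQP a)) = _
    congr 1
    apply Subtype.ext
    change θ (algebraMap F F' a) = algebraMap F F' a
    exact θ.commutes _
  let θA : Q.residueField →ₐ[P.residueField] Q.residueField :=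
    { θbar with commutes' := hcomm }
  obtain ⟨⟨m, hmlt⟩, hm⟩ := (FiniteField.bijective_frobeniusAlgHom_pow P.residueField Q.residueField).2 θA
  have hθpow : ∀ y : Q.residueField, θbar y = y ^ (Fintype.card K ^ (P.degree * m)) := by
    intro y
    have h := congr_arg (fun f : Q.residueField →ₐ[P.residueField] Q.residueField => f y) hm
    simp only [AlgHom.coe_pow, FiniteField.coe_frobeniusAlgHom, pow_iterate] at h
    rw [pow_mul, ← Nat.card_eq_fintype_card (α := K), ← PlaceOver.natCard_residueField P,
      Nat.card_eq_fintype_card]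
    exact h.symm
  -- on the constants `K'`: `θbar (c) = c^{q^i}`
  have hθconst : ∀ c : AdjoinRoot φ, θbar (algebraMap (AdjoinRoot φ) Q.residueField c) =
      algebraMap (AdjoinRoot φ) Q.residueField (c ^ (Fintype.card K ^ i)) := by
    intro c
    rw [PlaceOver.algebraMap_residueField_apply, PlaceOver.algebraMap_residueField_apply, hθbar,
      IsLocalRing.ResidueField.map_residue]
    congr 1
    apply Subtype.ext
    change θ (algebraMap (AdjoinRoot φ) F' c) = algebraMap (AdjoinRoot φ) F' (c ^ (Fintype.card K ^ i))
    rw [hθ, frob_pow_algebraMap]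
  -- compare the two descriptions on `K'`
  have hK' : ∀ c : AdjoinRoot φ, c ^ (Fintype.card K ^ i) = c ^ (Fintype.card K ^ (P.degree * m)) := by
    intro c
    apply (algebraMap (AdjoinRoot φ) Q.residueField).injective
    rw [← hθconst, hθpow, map_pow]
  haveI : Algebra.IsAlgebraic K (AdjoinRoot φ) := Algebra.IsAlgebraic.of_finite K _
  have hfrobK' : FiniteField.frobeniusAlgEquivOfAlgebraic K (AdjoinRoot φ) ^ i =
      FiniteField.frobeniusAlgEquivOfAlgebraic K (AdjoinRoot φ) ^ (P.degree * m) := by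
    apply DFunLike.ext; intro c
    simp only [AlgEquiv.coe_pow, FiniteField.coe_frobeniusAlgEquivOfAlgebraic, pow_iterate]
    exact hK' c
  rw [pow_eq_pow_iff_modEq, FiniteField.orderOf_frobeniusAlgEquivOfAlgebraic, finrank_adjoinRoot] at hfrobK'
  have h2 : i ≡ P.degree * m [MOD P.degree] := Nat.ModEq.of_dvd hst hfrobK'
  exact (Nat.modEq_zero_iff_dvd).1 (h2.trans ((Nat.modEq_zero_iff_dvd).2 (dvd_mul_right _ _)))

end Conjugates

/-! ### D. All places above a place of degree dividing `deg φ` are rational over `K'` -/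

section Rational

variable {K : Type u} {F : Type v} [Field K] [Fintype K] [Field F] [Algebra K F]
  [IsIntegrallyClosedIn K F] [IsAlgFunctionField K F]
variable (φ : K[X]) [hirr : Fact (Irreducible φ)]

/-- The places of `F'` above `P` form a finite set (they correspond to the primes of the integral
closure of `𝒪_P` above `P`). [cite: Stichtenoth2009, Prop. 3.1.7 / Cor. 3.3.5] -/
theorem finite_restrict_eq (P : PlaceOver K F) :
    Finite {Q' : PlaceOver (AdjoinRoot φ) (AdjoinRoot (φ.map (algebraMap K F))) //
      Q'.restrict (K := K) (F := F) = P} :=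
  haveI := isGalois_adjoinRoot_map (F := F) φ
  Finite.of_equiv _ (((Equiv.subtypeEquivRight fun Q => PlaceOver.restrict_eq_iff Q P).trans
    (PlaceOver.placesOverEquiv (K' := AdjoinRoot φ) P)).symm)

/-- There are at least `deg P` places of `F'` above a place `P` with `deg P ∣ deg φ` (the conjugates
`σ^i(Q)`, `i < deg P`, of any place `Q` above `P` are pairwise distinct, by
`degree_dvd_of_comapRingEquiv_frob_pow_eq`). [cite: Stichtenoth2009, Lemma 5.1.9(d)] -/
theorem degree_le_natCard_restrict_eq (P : PlaceOver K F) (hst : P.degree ∣ φ.natDegree)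
    (Q : PlaceOver (AdjoinRoot φ) (AdjoinRoot (φ.map (algebraMap K F))))
    (hQ : Q.restrict (K := K) (F := F) = P) :
    P.degree ≤ Nat.card {Q' : PlaceOver (AdjoinRoot φ) (AdjoinRoot (φ.map (algebraMap K F))) //
      Q'.restrict (K := K) (F := F) = P} := by
  haveI := finite_restrict_eq (F := F) φ P
  set F' := AdjoinRoot (φ.map (algebraMap K F)) with hF'
  set σ : F' ≃ₐ[F] F' := frob φ with hσ
  have hQP := (PlaceOver.restrict_eq_iff Q P).1 hQ
  let conj : Fin P.degree → {Q' : PlaceOver (AdjoinRoot φ) F' // Q'.restrict (K := K) (F := F) = P} :=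
    fun i => ⟨Q.comapRingEquiv ((σ ^ (i : ℕ) : F' ≃ₐ[F] F') : F' ≃+* F'),
      (PlaceOver.restrict_eq_iff _ P).2
        (PlaceOver.forall_algebraMap_mem_comapRingEquiv_iff (σ ^ (i : ℕ)) Q hQP)⟩
  have hinj : Function.Injective conj := by
    intro i j hij
    have h : Q.comapRingEquiv ((σ ^ (i : ℕ) : F' ≃ₐ[F] F') : F' ≃+* F') =
        Q.comapRingEquiv ((σ ^ (j : ℕ) : F' ≃ₐ[F] F') : F' ≃+* F') := congr_arg Subtype.val hij
    by_contra hne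
    wlog hlt : (i : ℕ) < j generalizing i j
    · exact this hij.symm h.symm (Ne.symm hne)
        (lt_of_le_of_ne (not_lt.1 hlt) fun h' => hne (Fin.ext h').symm)
    have hdecomp : Q.comapRingEquiv ((σ ^ (j : ℕ) : F' ≃ₐ[F] F') : F' ≃+* F') =
        (Q.comapRingEquiv ((σ ^ ((j : ℕ) - i) : F' ≃ₐ[F] F') : F' ≃+* F')).comapRingEquiv
          ((σ ^ (i : ℕ) : F' ≃ₐ[F] F') : F' ≃+* F') := by
      rw [PlaceOver.comapRingEquiv_comapRingEquiv]
      congr 1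
      apply RingEquiv.ext
      intro x
      change (σ ^ (j : ℕ)) x = (σ ^ ((j : ℕ) - i)) ((σ ^ (i : ℕ)) x)
      rw [← AlgEquiv.mul_apply, ← pow_add, Nat.sub_add_cancel hlt.le]
    rw [hdecomp] at h
    have hfix := (PlaceOver.comapRingEquiv_injective _ h).symm
    have hdvd := degree_dvd_of_comapRingEquiv_frob_pow_eq φ P Q hQP hst hfix
    have hlt' : (j : ℕ) - i < P.degree := lt_of_le_of_lt (Nat.sub_le _ _) j.2
    exact absurd (Nat.le_of_dvd (Nat.sub_pos_of_lt hlt) hdvd) (not_le.2 hlt')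
  calc P.degree = Nat.card (Fin P.degree) := by simp
    _ ≤ _ := Nat.card_le_card_of_injective conj hinj

/-- **All places above a place of degree dividing `deg φ` are rational** (Stichtenoth Thm. 3.6.3 (g)
/ Lemma 5.1.9 (d): in the constant field extension `F' = F𝔽_{q^t}`, a place `P` of degree `s`
with `s ∣ t` splits into `s` places of degree one). Proof: at least `s` places lie above `P`
(`degree_le_natCard_restrict_eq`); for each prime `𝔔` of the integral closure `B` of `𝒪_P` above
`P`, `B/𝔔` contains `K' = 𝔽_{q^t}`, so `s · f(𝔔|P) ≥ t`; and `#{𝔔} · e · f = [F' : F] = t` (Hilbert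
theory, Mathlib). Hence `s · f = t`, `#(B/𝔔) = #K'`, and `F'_Q = B/𝔔 = K'`.
[cite: Stichtenoth2009, Thm. 3.6.3(g) and Lemma 5.1.9(d)] -/
theorem isRational_of_restrict_eq (P : PlaceOver K F) (hst : P.degree ∣ φ.natDegree)
    (Q : PlaceOver (AdjoinRoot φ) (AdjoinRoot (φ.map (algebraMap K F))))
    (hQ : Q.restrict (K := K) (F := F) = P) : Q.IsRational := by
  haveI := isGalois_adjoinRoot_map (F := F) φ
  have hQP := (PlaceOver.restrict_eq_iff Q P).1 hQ
  haveI := P.finite_residueField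
  haveI : Finite (P.toValuationSubring ⧸ IsLocalRing.maximalIdeal P.toValuationSubring) :=
    ‹Finite P.residueField›
  haveI : PerfectField (IsLocalRing.maximalIdeal P.toValuationSubring).ResidueField := inferInstance
  have hq1 : 1 < Fintype.card K := Fintype.one_lt_card
  -- Hilbert theory: `#{𝔔} · |I| · f = [F' : F] = t`, with `#{𝔔} = #{Q' | P} ≥ s`
  have h1 := PlaceOver.natCard_restrict_eq (K' := AdjoinRoot φ)
    (Ω := AdjoinRoot (φ.map (algebraMap K F))) P
  have hH := Ideal.ncard_primesOver_mul_card_inertia_mul_finrank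
    (G := AdjoinRoot (φ.map (algebraMap K F)) ≃ₐ[F] AdjoinRoot (φ.map (algebraMap K F)))
    (IsLocalRing.maximalIdeal P.toValuationSubring) (PlaceOver.primeBelow Q hQP)
  rw [natCard_algEquiv_adjoinRoot_map, ← h1] at hH
  set n := Nat.card {Q' : PlaceOver (AdjoinRoot φ) (AdjoinRoot (φ.map (algebraMap K F))) //
    Q'.restrict (K := K) (F := F) = P} with hn
  set I := Nat.card ((PlaceOver.primeBelow Q hQP).inertia
    (AdjoinRoot (φ.map (algebraMap K F)) ≃ₐ[F] AdjoinRoot (φ.map (algebraMap K F)))) with hI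
  set f := (PlaceOver.primeBelow Q hQP).inertiaDeg P.toValuationSubring with hf
  have hns : P.degree ≤ n := degree_le_natCard_restrict_eq φ P hst Q hQ
  have hI1 : 1 ≤ I := Nat.one_le_iff_ne_zero.2 (by rw [hI]; exact Nat.card_pos.ne')
  -- `#(B/𝔔) = q^{s f}` and `B/𝔔 ⊇ K'`, so `s f ≥ t`
  have hcardB := PlaceOver.natCard_quotient_primeBelow_eq_pow Q hQP
  rw [PlaceOver.natCard_residueField P, ← pow_mul, Nat.card_eq_fintype_card (α := K)] at hcardB
  have hfs : φ.natDegree ≤ P.degree * f := by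
    letI := (PlaceOver.constHom (K' := AdjoinRoot φ) (P := P)
      (Ω := AdjoinRoot (φ.map (algebraMap K F)))).toAlgebra
    haveI : Finite (_ ⧸ PlaceOver.primeBelow Q hQP) :=
      Nat.finite_of_card_ne_zero (by rw [hcardB]; positivity)
    have h2 := Module.natCard_eq_pow_finrank (K := AdjoinRoot φ) (V := _ ⧸ PlaceOver.primeBelow Q hQP)
    have hpos : 0 < Module.finrank (AdjoinRoot φ) (_ ⧸ PlaceOver.primeBelow Q hQP) := by
      rw [pos_iff_ne_zero]
      intro h0
      rw [h0, pow_zero] at h2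
      exact (Finite.one_lt_card (α := _ ⧸ PlaceOver.primeBelow Q hQP)).ne' h2
    rw [hcardB, natCard_adjoinRoot, Nat.card_eq_fintype_card (α := K), ← pow_mul] at h2
    have h3 := Nat.pow_right_injective hq1 h2
    calc φ.natDegree ≤ φ.natDegree * Module.finrank (AdjoinRoot φ) (_ ⧸ PlaceOver.primeBelow Q hQP) :=
          Nat.le_mul_of_pos_right _ hpos
      _ = P.degree * f := h3.symm
  -- hence `s f = t`
  have hsf : P.degree * f = φ.natDegree := by
    apply le_antisymm _ hfs
    calc P.degree * f ≤ n * f := Nat.mul_le_mul_right _ hns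
      _ ≤ n * I * f := Nat.mul_le_mul_right _ (Nat.le_mul_of_pos_right _ hI1)
      _ = φ.natDegree := hH
  -- the residue field of `Q` has `#K'` elements
  have hres := PlaceOver.natCard_residueField_eq_natCard_quotient Q hQP
  rw [hcardB, hsf, ← Nat.card_eq_fintype_card, ← natCard_adjoinRoot φ] at hres
  have h3 := PlaceOver.natCard_residueField Q
  rw [hres] at h3
  have h4 : Nat.card (AdjoinRoot φ) ^ 1 = Nat.card (AdjoinRoot φ) ^ Q.degree := by rw [pow_one]; exact h3
  exact (Nat.pow_right_injective Finite.one_lt_card h4).symm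

end Rational

end Literature.NumberTheory.DiophantineGeometry.AlgFunctionField
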